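import Literature.MathematicalPhysics.QuantumLattice.XYOrderInfraredProofs
import HarnessLib

/-!
# The XXZ Hamiltonian is invariant under graph automorphisms

For the spin-`n/2` XXZ Hamiltonian `xxzHamiltonian n G J Δ = J Σ_{{x,y} ∈ E(G)} (S¹_xS¹_y + S²_xS²_y
+ Δ S³_xS³_y)` on a finite graph `G` and a permutation `π` of the sites preserving adjacency
(`G.Adj (π x) (π y) ↔ G.Adj x y`), relabelling the tensor indices by `σ ↦ σ ∘ π` fixes the
Hamiltonian (`xxzHamiltonian_submatrix_comp_of_adj_iff`): `π` permutes the bonds and maps each bond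
term to the bond term of the image bond (`spinBond_submatrix_comp`). On the torus `(ℤ/Lℤ)^d` this
applies to the translations (cf. `heisenbergTorus_submatrix_comp_addRight`,
`Summits/…/LevyLogBootstrapBlock2InfDivXXZKernelCovariance.xxzTorus_submatrix_comp_addRight`) and
to the permutations of the coordinate axes `x ↦ x ∘ s` (`xxzTorus_submatrix_comp_perm`, the
`Δ`-general form of `xyTorus_submatrix_comp_perm`), whence the isotropy of ground-state correlations
between the lattice directions. Tasaki (2020) §2.1 (symmetry of the Hamiltonian under lattice
automorphisms); Kennedy–Lieb–Shastry (1988) p. 1021. No definition is introduced; sorry-free.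
-/

noncomputable section

open Matrix Finset
open Literature.Probability.LatticeModels

namespace Literature.MathematicalPhysics.QuantumLattice

/-- **The XXZ Hamiltonian is invariant under graph automorphisms.** If `π` is a permutation of the
sites of a finite graph `G` preserving adjacency, then relabelling tensor indices by `σ ↦ σ ∘ π`
fixes `xxzHamiltonian n G J Δ` for all `n, J, Δ`. Tasaki (2020) §2.1. [folklore] -/
theorem xxzHamiltonian_submatrix_comp_of_adj_iff {Λ : Type*} [Fintype Λ] [DecidableEq Λ]
    (n : ℕ) (G : SimpleGraph Λ) [DecidableRel G.Adj] (J Δ : ℝ) (π : Λ ≃ Λ)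
    (hπ : ∀ x y : Λ, G.Adj (π x) (π y) ↔ G.Adj x y) :
    (xxzHamiltonian n G J Δ).submatrix (fun σ : TensorIndex Λ (n + 1) => σ ∘ π)
        (fun σ => σ ∘ π) = xxzHamiltonian n G J Δ := by
  have hmem : ∀ (ρ : Λ ≃ Λ), (∀ x y : Λ, G.Adj (ρ x) (ρ y) ↔ G.Adj x y) →
      ∀ e : Sym2 Λ, Sym2.map ρ e ∈ G.edgeFinset ↔ e ∈ G.edgeFinset := by
    intro ρ hρ e
    induction e using Sym2.ind with
    | h x y =>
      rw [Sym2.map_mk, SimpleGraph.mem_edgeFinset, SimpleGraph.mem_edgeSet,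
        SimpleGraph.mem_edgeFinset, SimpleGraph.mem_edgeSet, hρ]
  have hπ' : ∀ x y : Λ, G.Adj (π.symm x) (π.symm y) ↔ G.Adj x y := fun x y => by
    conv_rhs => rw [← π.apply_symm_apply x, ← π.apply_symm_apply y]
    exact (hπ _ _).symm
  simp only [xxzHamiltonian, submatrix_smul, Pi.smul_apply, submatrix_finset_sum]
  congr 1
  refine Finset.sum_nbij' (Sym2.map π) (Sym2.map π.symm) (fun e he => ?_) (fun e he => ?_)
    (fun e _ => ?_) (fun e _ => ?_) (fun e _ => ?_)
  · exact (hmem π hπ e).2 he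
  · exact (hmem π.symm hπ' e).2 he
  · simp only [Sym2.map_map, Equiv.symm_comp_self, Sym2.map_id', id_eq]
  · simp only [Sym2.map_map, Equiv.self_comp_symm, Sym2.map_id', id_eq]
  · induction e using Sym2.ind with
    | h x y =>
      simp only [Sym2.map_mk, Sym2.lift_mk, submatrix_add, submatrix_smul, Pi.add_apply,
        Pi.smul_apply, spinBond_submatrix_comp]

/-- **The XXZ Hamiltonian of the torus is invariant under permutations of the coordinate axes**
(`x ↦ x ∘ s`, acting on tensor indices by `σ ↦ σ ∘ π`), for every spin, `J` and anisotropy `Δ` —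
the `Δ`-general form of `xyTorus_submatrix_comp_perm`. [folklore] -/
theorem xxzTorus_submatrix_comp_perm {d : ℕ} (L : ℕ) [NeZero L] (n : ℕ) (J Δ : ℝ)
    (s : Equiv.Perm (Fin d)) :
    (xxzHamiltonian n (torusGraph d L) J Δ).submatrix
        (fun σ : TensorIndex (TorusSite d L) (n + 1) =>
          σ ∘ (Equiv.arrowCongr s.symm (Equiv.refl (ZMod L))))
        (fun σ => σ ∘ (Equiv.arrowCongr s.symm (Equiv.refl (ZMod L)))) =
      xxzHamiltonian n (torusGraph d L) J Δ :=
  xxzHamiltonian_submatrix_comp_of_adj_iff n (torusGraph d L) J Δ _ fun x y => by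
    rw [arrowCongr_symm_apply, arrowCongr_symm_apply]
    exact torusGraph_adj_comp_perm L s x y

/-- **The XXZ Hamiltonian of the torus is translation invariant** (`x ↦ x + v`), for every
dimension, spin, `J` and `Δ` (the torus graph is a circulant graph). Kennedy–Lieb–Shastry (1988)
p. 1021. [folklore] -/
theorem xxzTorus_submatrix_comp_addRight' {d : ℕ} (L : ℕ) [NeZero L] (n : ℕ) (J Δ : ℝ)
    (v : TorusSite d L) :
    (xxzHamiltonian n (torusGraph d L) J Δ).submatrix
        (fun σ : TensorIndex (TorusSite d L) (n + 1) => σ ∘ Equiv.addRight v)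
        (fun σ => σ ∘ Equiv.addRight v) =
      xxzHamiltonian n (torusGraph d L) J Δ :=
  xxzHamiltonian_submatrix_comp_of_adj_iff n (torusGraph d L) J Δ _ fun _ _ =>
    SimpleGraph.circulantGraph_adj_translate

end Literature.MathematicalPhysics.QuantumLattice

end
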